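import Summits.Ventures.Crystal3D.Bulk.GapActiveFaces
import HarnessLib

/-!
# P-L3(b) L2 for the GAP census: the tight graph of a census configuration has NO CUT VERTEX
# (route 1 of `HOME/lean/lemmaL/DESIGN.md`, consequence of LEMMA L)

HONEST FRAMING. Part of the venture `Summits/Ventures/Crystal3D` (cell `pub-crystal3d`, phase 2;
seat p3). Kernel theorem about every configuration satisfying `CensusRows c`; nothing is claimed
about GAP(1.26). Row P-L3(b) L2 of the cell's `DESIGN-L12-THEORY.md` ("`T′` has no cut vertex";
proved there by an isoperimetric argument, an assumption of the census's plantri class) follows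
here WITHOUT isoperimetry from the kernel facts "`T′` is connected" (`CensusRows.tightConnected`,
p3 g7) and "every face walk has pairwise distinct vertices"
(`CensusRows.fst_iterate_ofaceSucc_injOn`, LEMMA L, `Bulk/GapActiveFaces.lean`): if removing the
active vertex `v` separated `A` from `B`, then around `v` (whose tight partners the oriented
rotation `onextNbr c v` permutes in ONE cycle) some partner `a' ∈ A` is followed by `b' ∈ B`;
the face through the dart `a' → v` continues `v → b'` and, all its later edges being tight edges
avoiding… unable to re-enter `A` except through `v`, passes through `v` a second time —
contradicting the distinctness of its vertices.

* `CensusRows.exists_iterate_onextNbr_eq` — `onextNbr c v` acts transitively on `tightNbrs c v`;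
* **`CensusRows.tightTwoConnected`** — for every active vertex `v` and every nonempty
  `A ⊆ activeVertices c ∖ {v}` closed under tight adjacency avoiding `v`,
  `A = activeVertices c ∖ {v}`: the tight graph minus any one vertex is still connected.
-/

noncomputable section

namespace Summit.Ventures.Crystal3D

open Literature.Geometry.DiscreteGeometry Finset Equiv HullRotSys Function

variable {c : Fin 14 → EuclideanSpace ℝ (Fin 3)}

/-! ## The oriented rotation at a vertex is transitive on the tight partners -/

/-- Iterates of `onextNbr c v` stay among the tight partners. -/
theorem CensusRows.iterate_onextNbr_mem (h : CensusRows c) {v : Fin 14} (hv0 : v ≠ 0) {x : Fin 14}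
    (hx : x ∈ tightNbrs c v) (k : ℕ) : (onextNbr c v)^[k] x ∈ tightNbrs c v := by
  induction k with
  | zero => exact hx
  | succ k ih => rw [iterate_succ_apply']; exact h.isGapConfig.onextNbr_mem h.intruderDist_bounds.1 hv0 ih

/-- **`onextNbr c v` permutes the tight partners of `v` in ONE cycle**: any partner is reached
from any other (read off the hull rotation system of the active hull, where the `S`-darts at a
vertex lie on one `σ_H`-cycle). -/
theorem CensusRows.exists_iterate_onextNbr_eq (h : CensusRows c) {v : Fin 14} (hv0 : v ≠ 0)
    {x y : Fin 14} (hx : x ∈ tightNbrs c v) (hy : y ∈ tightNbrs c v) :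
    ∃ k, (onextNbr c v)^[k] x = y := by
  have hD := h.intruderDist_lt_three_halves
  have hD2 : intruderDist c < 2 := by linarith
  set hX1 := h.isGapConfig.norm_of_mem_activeDirSet
  set h0 := h.zero_mem_interior_convexHull_activeDirSet
  set S := tightDartsIn c (activeDirSet c)
  have hqx : (v, x) ∈ darts c := mk_mem_darts hv0 hx
  have hqy : (v, y) ∈ darts c := mk_mem_darts hv0 hy
  set dx : ↥(hullDarts (activeDirSet c)) := ⟨dirPair c (v, x), h.dirPair_mem_hullDarts_active _ hqx⟩
  set dy : ↥(hullDarts (activeDirSet c)) := ⟨dirPair c (v, y), h.dirPair_mem_hullDarts_active _ hqy⟩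
  have hdx : dx ∈ S := mem_tightDartsIn.2 ⟨(v, x), hqx, rfl⟩
  have hdy : dy ∈ S := mem_tightDartsIn.2 ⟨(v, y), hqy, rfl⟩
  -- same tail ⇒ same `σ_H`-cycle ⇒ same cycle of the induced rotation
  have hsc : (RotSys.induce (rot hX1 h0) S).SameCycle dx dy := by
    rw [RotSys.sameCycle_induce_iff _ hdx hdy, sameCycle_rot_iff]
    rfl
  obtain ⟨k, hk⟩ := hsc.exists_nat_pow_eq
  refine ⟨k, ?_⟩
  -- iterate `induce = onextNbr` along the powers
  have hiter : ∀ n, ((RotSys.induce (rot hX1 h0) S ^ n) dx).1 =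
      dirPair c (v, (onextNbr c v)^[n] x) := by
    intro n
    induction n with
    | zero => rfl
    | succ n ih =>
      have hqn : (v, (onextNbr c v)^[n] x) ∈ darts c :=
        mk_mem_darts hv0 (h.iterate_onextNbr_mem hv0 hx n)
      rw [pow_succ', Perm.mul_apply,
        h.isGapConfig.induce_rot_val_of hD hX1 h0 h.dirPair_mem_hullDarts_active hqn ih,
        iterate_succ_apply']
  have hval := congrArg Subtype.val hk
  rw [hiter k] at hval
  have hqk : (v, (onextNbr c v)^[k] x) ∈ darts c := mk_mem_darts hv0 (h.iterate_onextNbr_mem hv0 hx k)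
  have := h.isGapConfig.dirPair_injOn hD2 (Finset.mem_coe.2 hqk) (Finset.mem_coe.2 hqy) hval
  exact (Prod.mk.inj this).2

/-! ## No cut vertex -/

/-- **P-L3(b) L2: the tight graph has no cut vertex.** For every active vertex `v`, every
nonempty set `A` of active vertices other than `v` which contains, with a vertex, every tight
partner of it other than `v`, is ALL of `activeVertices c ∖ {v}`. -/
theorem CensusRows.tightTwoConnected (h : CensusRows c) {v : Fin 14} (hv : v ∈ activeVertices c)
    {A : Finset (Fin 14)} (hA : A ⊆ (activeVertices c).erase v) (hAne : A.Nonempty)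
    (hAcl : ∀ i ∈ A, ∀ j : Fin 14, (i, j) ∈ darts c → j ≠ v → j ∈ A) :
    A = (activeVertices c).erase v := by
  classical
  obtain ⟨hv0, -⟩ := mem_activeVertices.1 hv
  by_contra hne
  -- the complement `B`, also nonempty and closed avoiding `v`
  set B := ((activeVertices c).erase v) \ A with hB
  have hBne : B.Nonempty := by
    rw [hB, sdiff_nonempty]; exact fun hsub => hne (Subset.antisymm hA hsub)
  have hBcl : ∀ i ∈ B, ∀ j : Fin 14, (i, j) ∈ darts c → j ≠ v → j ∈ B := by
    intro i hi j hij hjv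
    rw [hB, mem_sdiff] at hi ⊢
    refine ⟨mem_erase.2 ⟨hjv, ?_⟩, fun hjA => hi.2 (hAcl j hjA i (swap_mem_darts hij) ?_)⟩
    · rw [← image_fst_darts]; exact mem_image_of_mem _ (swap_mem_darts hij)
    · rintro rfl; exact (mem_erase.1 hi.1).1 rfl
  -- `A` and `B` both touch `v` (else `A ∪ …` would violate connectedness)
  have htouch : ∀ {C : Finset (Fin 14)}, C ⊆ (activeVertices c).erase v → C.Nonempty →
      (∀ i ∈ C, ∀ j : Fin 14, (i, j) ∈ darts c → j ≠ v → j ∈ C) →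
      C ≠ (activeVertices c).erase v → ∃ a ∈ C, (a, v) ∈ darts c := by
    intro C hC hCne hCcl hCne'
    by_contra hno
    push Not at hno
    -- then `C` is closed under ALL tight adjacency, so `C = activeVertices c ∋ v`: absurd
    have hcl : ∀ i ∈ C, ∀ j : Fin 14, (i, j) ∈ darts c → j ∈ C := by
      intro i hi j hij
      by_cases hjv : j = v
      · subst hjv; exact absurd hij (hno i hi)
      · exact hCcl i hi j hij hjv
    have hall := h.tightConnected C (hC.trans (erase_subset _ _)) hCne hcl
    have : v ∈ C := by rw [hall]; exact hv
    exact (mem_erase.1 (hC this)).1 rfl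
  have hBsub : B ⊆ (activeVertices c).erase v := sdiff_subset
  have hBne' : B ≠ (activeVertices c).erase v := by
    intro hBall
    obtain ⟨a, ha⟩ := hAne
    have : a ∈ B := by rw [hBall]; exact hA ha
    rw [hB, mem_sdiff] at this
    exact this.2 ha
  obtain ⟨a, haA, hav⟩ := htouch hA hAne hAcl hne
  obtain ⟨b, hbB, hbv⟩ := htouch hBsub hBne hBcl hBne'
  have ha : a ∈ tightNbrs c v := by
    have := snd_mem_tightNbrs_of_mem_darts (swap_mem_darts hav); simpa using this
  have hb : b ∈ tightNbrs c v := by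
    have := snd_mem_tightNbrs_of_mem_darts (swap_mem_darts hbv); simpa using this
  -- a transition `a' ∈ A`, `onextNbr c v a' ∉ A` along the rotation at `v`
  obtain ⟨k, hk⟩ := h.exists_iterate_onextNbr_eq hv0 ha hb
  have hbA : b ∉ A := by rw [hB, mem_sdiff] at hbB; exact hbB.2
  obtain ⟨k0, hk0A, hk0⟩ : ∃ k0, (onextNbr c v)^[k0] a ∈ A ∧ (onextNbr c v)^[k0 + 1] a ∉ A := by
    by_contra hno
    push Not at hno
    have : ∀ n, (onextNbr c v)^[n] a ∈ A := by
      intro n; induction n with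
      | zero => exact haA
      | succ n ih => exact hno n ih
    exact hbA (hk ▸ this k)
  set a' := (onextNbr c v)^[k0] a with ha'
  set b' := (onextNbr c v)^[k0 + 1] a with hb'
  have hb'eq : b' = onextNbr c v a' := by rw [hb', iterate_succ_apply']
  have ha't : a' ∈ tightNbrs c v := h.iterate_onextNbr_mem hv0 ha k0
  have hb't : b' ∈ tightNbrs c v := h.iterate_onextNbr_mem hv0 ha (k0 + 1)
  have hb'B : b' ∈ B := by
    rw [hB, mem_sdiff]
    refine ⟨mem_erase.2 ⟨(mem_tightNbrs.1 hb't).2.1, ?_⟩, hk0⟩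
    exact mem_activeVertices_of_mem_tightNbrs hv0 hb't
  -- the face through the dart `a' → v`: tails `a', v, b', …`
  set q : Fin 14 × Fin 14 := (a', v) with hqdef
  have hq : q ∈ darts c := swap_mem_darts (mk_mem_darts hv0 ha't)
  set t : ℕ → Fin 14 := fun n => ((ofaceSucc c)^[n] q).1 with ht
  have ht0 : t 0 = a' := rfl
  have ht1 : t 1 = v := rfl
  have ht2 : t 2 = b' := by
    rw [ht]; simp only
    rw [show (2 : ℕ) = 1 + 1 from rfl, iterate_succ_apply', iterate_one]
    show (ofaceSucc c (ofaceSucc c (a', v))).1 = b'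
    rw [hb'eq]; rfl
  set m := ofaceLen c q with hm
  have hm3 : 3 ≤ m := h.three_le_ofaceLen hq
  have htm : t m = a' := by
    rw [ht]; simp only; rw [hm, iterate_ofaceLen]
  -- consecutive tails are tight pairs
  have hstep : ∀ n, (t n, t (n + 1)) ∈ darts c := by
    intro n
    have := h.isGapConfig.iterate_ofaceSucc_mem_darts h.intruderDist_bounds.1 hq n
    rw [ht]; simp only
    rw [iterate_succ_apply']
    exact this
  -- no later visit of `v`: the tails from index 2 on stay in `B`, but `t m = a' ∈ A`
  have hnov : ∀ n, 2 ≤ n → n < m → t n ≠ v := by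
    intro n hn2 hnm heq
    exact h.fst_iterate_ofaceSucc_injOn hq (show 1 < n by omega) hnm (by rw [← ht1] at heq; exact heq.symm)
  have hstay : ∀ n, 2 ≤ n → n ≤ m → t n ∈ B := by
    intro n hn2
    induction n with
    | zero => intro _; omega
    | succ n ih =>
      intro hnm
      rcases Nat.lt_or_ge n 2 with hn | hn
      · have : n = 1 := by omega
        subst this
        rw [ht2]; exact hb'B
      · have hnB := ih hn (by omega)
        refine hBcl _ hnB _ (hstep n) ?_
        rcases Nat.lt_or_ge (n + 1) m with hlt | hge
        · exact hnov (n + 1) (by omega) hlt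
        · have : n + 1 = m := by omega
          rw [this, htm]
          exact (mem_tightNbrs.1 ha't).2.1
  have haB : a' ∈ B := htm ▸ hstay m (by omega) le_rfl
  rw [hB, mem_sdiff] at haB
  exact haB.2 hk0A

end Summit.Ventures.Crystal3D
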